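import Mathlib
import Summits.Ventures.PercRepro.TriangleCapOffPairs

/-!
# PercRepro — the counts at a vertex of a `K₄⁻`-free graph: `A = d + E₁`, `2E₁ ≤ |R| + T`, `T ≤ d`,
`2m = 2d + |R|`, the disjoint matching pair, and the two sums over the pairs off `v`
(p3, gen 30; part 2 of the row `m = k + 1`)

With `N(v)` the neighbourhood of `v` (`d = d(v)`), `R = offPairs D v`, `E₁` the pairs of `R` starting in `N(v)`
and `T` the matching pairs (both coordinates in `N(v)`):

* `sum_deg_neighbors_eq` — `Σ_{w ∈ N(v)} d(w) = d + E₁`;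
* `card_T_le_deg` — `T ≤ d` (each neighbour starts at most one matching pair: the matching property);
* `card_E_fst_eq_snd`, `two_mul_card_E_le` — `E₁ = E₂` by the swap and `2E₁ ≤ |R| + T`;
* `two_mul_card_edges_eq` — `2m = d + (d + |R|)`;
* `sum_R_le` — the exact per-pair bound summed: `S_R + |R|·d ≤ |R|·m + |R| + 2E₁`;
* `exists_disjoint_matching_pair` — with `T ≥ 3` every matching pair has a matching pair disjoint from it;
* `sum_R_le_of_three_le` — the refined sum: `S_R + |R|·d + T ≤ |R|·m + |R| + 2E₁` when `T ≥ 3`.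

Axioms: standard.
-/

namespace PercRepro

namespace TriangleCap

namespace C047

open Finset

variable {V : Type*} [Fintype V] [DecidableEq V]
/-- `A = d + E₁`: the neighbours of `v` carry `d(v)` plus the number of pairs off `v` starting in `N(v)`. -/
theorem sum_deg_neighbors_eq (D : SimpleGraph V) [DecidableRel D.Adj] (v : V) :
    ∑ w ∈ univ.filter (fun w => D.Adj v w), deg D w =
      deg D v + ((offPairs D v).filter (fun p => D.Adj v p.1)).card := by
  rw [filter_offPairs_fst_eq, card_filter_product_adj]
  have h : ∀ w ∈ univ.filter (fun w => D.Adj v w),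
      deg D w = 1 + ((univ.erase v).filter (fun x => D.Adj w x)).card := by
    intro w hw
    have hvw : D.Adj w v := (mem_filter.mp hw).2.symm
    unfold deg
    rw [filter_erase, ← card_erase_add_one (mem_filter.mpr ⟨mem_univ v, hvw⟩)]
    ring
  rw [sum_congr rfl h, sum_add_distrib, sum_const, smul_eq_mul, mul_one]
  rfl

/-- `T ≤ d`: the matching pairs of `N(v)` number at most `d(v)` (each neighbour starts at most one). -/
theorem card_T_le_deg (D : SimpleGraph V) [DecidableRel D.Adj] (hK : K4mFree D) (v : V) :
    ((offPairs D v).filter (fun p => D.Adj v p.1 ∧ D.Adj v p.2)).card ≤ deg D v := by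
  rw [filter_offPairs_both_eq, card_filter_product_adj]
  calc ∑ w ∈ univ.filter (fun w => D.Adj v w),
        ((univ.filter (fun w => D.Adj v w)).filter (fun x => D.Adj w x)).card
      ≤ ∑ _w ∈ univ.filter (fun w => D.Adj v w), 1 :=
        sum_le_sum (fun w hw => card_filter_adj_neighbors_le_one D hK (mem_filter.mp hw).2)
    _ = deg D v := by rw [sum_const, smul_eq_mul, mul_one]; rfl

/-- The swap of a pair off `v` is a pair off `v`. -/
theorem swap_mem_offPairs (D : SimpleGraph V) [DecidableRel D.Adj] (v : V) {p : V × V}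
    (hp : p ∈ offPairs D v) : p.swap ∈ offPairs D v := by
  rw [mem_offPairs] at hp ⊢
  rw [Prod.fst_swap, Prod.snd_swap]
  exact ⟨hp.1.symm, hp.2.2, hp.2.1⟩

/-- `E₁ = E₂` by the swap. -/
theorem card_E_fst_eq_snd (D : SimpleGraph V) [DecidableRel D.Adj] (v : V) :
    ((offPairs D v).filter (fun p => D.Adj v p.1)).card =
      ((offPairs D v).filter (fun p => D.Adj v p.2)).card := by
  apply card_nbij' Prod.swap Prod.swap
  · intro p hp
    simp only [mem_coe, mem_filter, Prod.snd_swap] at hp ⊢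
    exact ⟨swap_mem_offPairs D v hp.1, hp.2⟩
  · intro p hp
    simp only [mem_coe, mem_filter, Prod.fst_swap] at hp ⊢
    exact ⟨swap_mem_offPairs D v hp.1, hp.2⟩
  · intro p _
    exact Prod.swap_swap p
  · intro p _
    exact Prod.swap_swap p

/-- `2E₁ ≤ |R| + T`: a pair off `v` has at most one coordinate in `N(v)` unless it is a matching pair. -/
theorem two_mul_card_E_le (D : SimpleGraph V) [DecidableRel D.Adj] (v : V) :
    2 * ((offPairs D v).filter (fun p => D.Adj v p.1)).card ≤
      (offPairs D v).card + ((offPairs D v).filter (fun p => D.Adj v p.1 ∧ D.Adj v p.2)).card := by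
  rw [two_mul]
  nth_rewrite 2 [card_E_fst_eq_snd]
  set R := offPairs D v with hR
  clear_value R
  rw [card_filter, card_filter, card_filter, card_eq_sum_ones, ← sum_add_distrib, ← sum_add_distrib]
  apply sum_le_sum
  intro p _
  by_cases h1 : D.Adj v p.1 <;> by_cases h2 : D.Adj v p.2 <;> simp [h1, h2]

/-- `2m = 2d + |R|`: the adjacent ordered pairs are the `2d` touching `v` and those off `v`. -/
theorem two_mul_card_edges_eq (D : SimpleGraph V) [DecidableRel D.Adj] (v : V) :
    2 * D.edgeFinset.card = deg D v + (deg D v + (offPairs D v).card) := by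
  have hc1 := card_filter_add_card_filter_not (s := adjPairsAll D) (fun p => p.1 = v)
  have hc2 := card_filter_add_card_filter_not (s := (adjPairsAll D).filter (fun p => ¬ p.1 = v))
    (fun p => p.2 = v)
  rw [filter_not_fst_filter_snd, filter_not_fst_filter_not_snd] at hc2
  rw [card_adjPairsAll, card_filter_fst_eq] at hc1
  rw [card_filter_snd_eq] at hc2
  omega

/-- **The sum over the pairs off `v`, exact form:** `S_R + |R|·d ≤ |R|(m + 1) + 2E₁`. -/
theorem sum_R_le (D : SimpleGraph V) [DecidableRel D.Adj] (v : V) :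
    ∑ p ∈ offPairs D v, (deg D p.1 + deg D p.2) + (offPairs D v).card * deg D v ≤
      (offPairs D v).card * D.edgeFinset.card + (offPairs D v).card +
        2 * ((offPairs D v).filter (fun p => D.Adj v p.1)).card := by
  have h : ∑ p ∈ offPairs D v, (deg D p.1 + deg D p.2 + deg D v) ≤
      ∑ p ∈ offPairs D v, (D.edgeFinset.card + 1 + (if D.Adj v p.1 then 1 else 0) +
        (if D.Adj v p.2 then 1 else 0)) := by
    apply sum_le_sum
    intro p hp
    rw [mem_offPairs] at hp
    exact deg_add_deg_add_deg_le_of_adj_ind D hp.1 hp.2.1 hp.2.2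
  simp only [sum_add_distrib, sum_const, smul_eq_mul] at h
  rw [← card_filter, ← card_filter, ← card_E_fst_eq_snd, mul_one] at h
  rw [sum_add_distrib]
  omega

/-- **Another matching pair, disjoint:** if `N(v)` carries at least `3` ordered matching pairs, every matching
pair `(x, y)` has a matching pair `(a, b)` with `a, b ∉ {x, y}`. -/
theorem exists_disjoint_matching_pair (D : SimpleGraph V) [DecidableRel D.Adj] (hK : K4mFree D) (v : V)
    (h3 : 3 ≤ ((offPairs D v).filter (fun p => D.Adj v p.1 ∧ D.Adj v p.2)).card)
    {p : V × V} (hp : p ∈ (offPairs D v).filter (fun p => D.Adj v p.1 ∧ D.Adj v p.2)) :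
    ∃ q ∈ (offPairs D v).filter (fun p => D.Adj v p.1 ∧ D.Adj v p.2),
      q.1 ≠ p.1 ∧ q.1 ≠ p.2 ∧ q.2 ≠ p.1 ∧ q.2 ≠ p.2 := by
  -- membership in the matching pairs unpacked
  have hmem : ∀ q ∈ (offPairs D v).filter (fun p => D.Adj v p.1 ∧ D.Adj v p.2),
      D.Adj q.1 q.2 ∧ D.Adj v q.1 ∧ D.Adj v q.2 := by
    intro q hq
    rw [mem_filter, mem_offPairs] at hq
    exact ⟨hq.1.1, hq.2⟩
  -- two matching pairs with the same first coordinate coincide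
  have hinj : ∀ q ∈ (offPairs D v).filter (fun p => D.Adj v p.1 ∧ D.Adj v p.2),
      ∀ q' ∈ (offPairs D v).filter (fun p => D.Adj v p.1 ∧ D.Adj v p.2), q.1 = q'.1 → q = q' := by
    intro q hq q' hq' he
    obtain ⟨h1, h2, h3'⟩ := hmem q hq
    obtain ⟨h1', _, h3''⟩ := hmem q' hq'
    have hle := card_filter_adj_neighbors_le_one D hK h2
    rw [card_le_one] at hle
    have hq2 : q.2 ∈ (univ.filter (fun x => D.Adj v x)).filter (fun x => D.Adj q.1 x) :=
      mem_filter.mpr ⟨mem_filter.mpr ⟨mem_univ _, h3'⟩, h1⟩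
    have hq2' : q'.2 ∈ (univ.filter (fun x => D.Adj v x)).filter (fun x => D.Adj q.1 x) :=
      mem_filter.mpr ⟨mem_filter.mpr ⟨mem_univ _, h3''⟩, he ▸ h1'⟩
    exact Prod.ext he (hle _ hq2 _ hq2')
  -- the pairs starting at `p.1` or `p.2` are at most two
  have hF : (((offPairs D v).filter (fun p => D.Adj v p.1 ∧ D.Adj v p.2)).filter
      (fun q => q.1 = p.1 ∨ q.1 = p.2)).card ≤ 2 := by
    refine (card_le_card_of_injOn Prod.fst (t := {p.1, p.2}) ?_ ?_).trans card_le_two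
    · intro q hq
      rw [mem_coe, mem_filter] at hq
      rw [mem_coe, mem_insert, mem_singleton]
      exact hq.2
    · intro q hq q' hq' he
      rw [mem_coe, mem_filter] at hq hq'
      exact hinj q hq.1 q' hq'.1 he
  have hlt : (((offPairs D v).filter (fun p => D.Adj v p.1 ∧ D.Adj v p.2)).filter
      (fun q => q.1 = p.1 ∨ q.1 = p.2)).card <
      ((offPairs D v).filter (fun p => D.Adj v p.1 ∧ D.Adj v p.2)).card := by omega
  obtain ⟨q, hq, hqF⟩ := exists_mem_notMem_of_card_lt_card hlt
  rw [mem_filter, not_and] at hqF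
  have hq1 : ¬ (q.1 = p.1 ∨ q.1 = p.2) := hqF hq
  push Not at hq1
  refine ⟨q, hq, hq1.1, hq1.2, ?_, ?_⟩
  · -- `q.2 = p.1` would put `q.1` and `p.2` both in `N(v) ∩ N(p.1)`
    intro he
    obtain ⟨hq12, hvq1, _⟩ := hmem q hq
    obtain ⟨hp12, hvp1, hvp2⟩ := hmem p hp
    have hle := card_filter_adj_neighbors_le_one D hK hvp1
    rw [card_le_one] at hle
    have ha : q.1 ∈ (univ.filter (fun x => D.Adj v x)).filter (fun x => D.Adj p.1 x) :=
      mem_filter.mpr ⟨mem_filter.mpr ⟨mem_univ _, hvq1⟩, he ▸ hq12.symm⟩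
    have hb : p.2 ∈ (univ.filter (fun x => D.Adj v x)).filter (fun x => D.Adj p.1 x) :=
      mem_filter.mpr ⟨mem_filter.mpr ⟨mem_univ _, hvp2⟩, hp12⟩
    exact hq1.2 (hle _ ha _ hb)
  · intro he
    obtain ⟨hq12, hvq1, _⟩ := hmem q hq
    obtain ⟨hp12, hvp1, hvp2⟩ := hmem p hp
    have hle := card_filter_adj_neighbors_le_one D hK hvp2
    rw [card_le_one] at hle
    have ha : q.1 ∈ (univ.filter (fun x => D.Adj v x)).filter (fun x => D.Adj p.2 x) :=
      mem_filter.mpr ⟨mem_filter.mpr ⟨mem_univ _, hvq1⟩, he ▸ hq12.symm⟩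
    have hb : p.1 ∈ (univ.filter (fun x => D.Adj v x)).filter (fun x => D.Adj p.2 x) :=
      mem_filter.mpr ⟨mem_filter.mpr ⟨mem_univ _, hvp1⟩, hp12.symm⟩
    exact hq1.1 (hle _ ha _ hb)

/-- **The sum over the pairs off `v`, refined form:** with `≥ 3` matching pairs,
`S_R + |R|·d + T ≤ |R|(m + 1) + 2E₁`. -/
theorem sum_R_le_of_three_le (D : SimpleGraph V) [DecidableRel D.Adj] (hK : K4mFree D) (v : V)
    (h3 : 3 ≤ ((offPairs D v).filter (fun p => D.Adj v p.1 ∧ D.Adj v p.2)).card) :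
    ∑ p ∈ offPairs D v, (deg D p.1 + deg D p.2) + (offPairs D v).card * deg D v +
        ((offPairs D v).filter (fun p => D.Adj v p.1 ∧ D.Adj v p.2)).card ≤
      (offPairs D v).card * D.edgeFinset.card + (offPairs D v).card +
        2 * ((offPairs D v).filter (fun p => D.Adj v p.1)).card := by
  have h : ∑ p ∈ offPairs D v,
      (deg D p.1 + deg D p.2 + deg D v + (if D.Adj v p.1 ∧ D.Adj v p.2 then 1 else 0)) ≤
      ∑ p ∈ offPairs D v, (D.edgeFinset.card + 1 + (if D.Adj v p.1 then 1 else 0) +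
        (if D.Adj v p.2 then 1 else 0)) := by
    apply sum_le_sum
    intro p hp
    have hp' := hp
    rw [mem_offPairs] at hp'
    by_cases hboth : D.Adj v p.1 ∧ D.Adj v p.2
    · rw [if_pos hboth, if_pos hboth.1, if_pos hboth.2]
      have hpT : p ∈ (offPairs D v).filter (fun p => D.Adj v p.1 ∧ D.Adj v p.2) :=
        mem_filter.mpr ⟨hp, hboth⟩
      obtain ⟨q, hq, hq1, hq2, hq3, hq4⟩ := exists_disjoint_matching_pair D hK v h3 hpT
      rw [mem_filter, mem_offPairs] at hq
      have := deg_add_deg_add_deg_le_of_adj_of_disjoint_edge D hp'.1 hp'.2.1 hp'.2.2 hq.1.1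
        hq.1.2.1 hq.1.2.2 hq1 hq2 hq3 hq4
      omega
    · rw [if_neg hboth]
      have := deg_add_deg_add_deg_le_of_adj_ind D hp'.1 hp'.2.1 hp'.2.2
      omega
  simp only [sum_add_distrib, sum_const, smul_eq_mul] at h
  rw [← card_filter, ← card_filter, ← card_filter, ← card_E_fst_eq_snd, mul_one] at h
  rw [sum_add_distrib]
  omega

end C047

end TriangleCap

end PercRepro
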